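import Summits.NavierStokesRegularity.NavierStokesRegularity.Theorems.AdaptedFrequencyAdaptedKernelExistsLowerOfUpperBridge
import Summits.NavierStokesRegularity.NavierStokesRegularity.Theorems.AdaptedFrequencyAdaptedFrequencyConvergesStubDoeblinTools

/-!
# Crux `AdaptedFrequencyConverges` (stmt-NavierStokesRegularity-10493), line
  `cloud-frame-effective-tsai`: the minorisation bridge for STUB `stub_doeblin`

Helper file (theorems only; lands `--supports stmt-NavierStokesRegularity-10493`) for the
registered stub `stub_doeblin`. The Doeblin step needs a pointwise LOWER bound, at the bottom
`σ` of a block `[σ, σ₃]`, of a nonnegative classical solution `W` of the adjoint equation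
`∂ₜW + b·∇W + νΔW = 0` (given on an open time interval `(σ₀, σ') ⊃ [σ, σ₃]`), by the mass of a
weight `0 ≤ φ ≤ W(σ₃, ·)` carried by a ball `B̄(x₀, r_s)`. Exactly as the tree's
`lowerOfUpper_bridge` / `lowerOfUpper_pointwise` (line `nash-entropy-last-block` of
`AdaptedKernelExists`, there for an adapted kernel), the reversed and rescaled function
`v(s, x) = W(σ₃ − s/ν, x)`, `s ∈ [0, ν(σ₃ − σ)]`, belongs to the local time-integrated class
`IsDriftHeatSolutionOn a v (B/ν) (Icc 0 (ν(σ₃−σ))) univ` (`doeblin_block_bridge`), and the tree's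
Gaussian comparison `IsDriftHeatSolutionOn.kernel_lower_bound` on balls `B̄(x₀, ρ′)`, `ρ′ → ∞`,
gives `(∫ φ) · kSubLow 3 (B/ν) (r_e + r_s) (ν(σ₃ − σ)) ≤ W(σ, x)` on `B̄(x₀, r_e)`
(`doeblin_block_lower`).
-/

noncomputable section

namespace Summit.NavierStokesRegularity.NavierStokesRegularity.Theorems.AdaptedFrequencyConverges.CloudFrameEffectiveTsai

open scoped Topology Laplacian
open Literature.Analysis.FluidPDE Set Filter MeasureTheory Function Metric Real
open Summit.NavierStokesRegularity.NavierStokesRegularity.Theorems.AdaptedKernelExists.NashEntropyLastBlock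

/-- Bookkeeping of the reversed time `σ₃ − s/ν`: for `s ∈ [0, ν(σ₃ − σ)]` it lies in `[σ, σ₃]`
and the clamp `max σ (min σ₃ ·)` does nothing. -/
theorem doeblin_clamp {ν σ σ₃ s : ℝ} (hν : 0 < ν) (hs : s ∈ Icc 0 (ν * (σ₃ - σ))) :
    max σ (min σ₃ (σ₃ - s / ν)) = σ₃ - s / ν ∧ σ₃ - s / ν ∈ Icc σ σ₃ := by
  have h1 : 0 ≤ s / ν := div_nonneg hs.1 hν.le
  have h2 : s / ν ≤ σ₃ - σ := by rw [div_le_iff₀ hν]; linarith [hs.2]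
  refine ⟨?_, by linarith, by linarith⟩
  rw [min_eq_right (by linarith), max_eq_right (by linarith)]

/-- Time slices of a function jointly `C²` on `I × ℝ³` are `C²` (any time set `I`). -/
theorem doeblin_contDiff_slice_open {I : Set ℝ} {W : ℝ → EuclideanSpace ℝ (Fin 3) → ℝ}
    (hc : ContDiffOn ℝ 2 (uncurry W) (I ×ˢ univ)) {τ : ℝ} (hτ : τ ∈ I) : ContDiff ℝ 2 (W τ) := by
  have h1 : ContDiff ℝ 2
      (fun x : EuclideanSpace ℝ (Fin 3) => ((τ, x) : ℝ × EuclideanSpace ℝ (Fin 3))) :=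
    contDiff_const.prodMk contDiff_id
  have := hc.comp_contDiff h1 (fun x => mk_mem_prod hτ (mem_univ x))
  simpa [Function.comp_def] using this

/-- **The bridge.** For a jointly `C²` solution `W` of `∂ₜW + b·∇W + νΔW = 0` on an open time
interval `(σ₀, σ') × ℝ³`, a block `[σ, σ₃] ⊂ (σ₀, σ')` on which the (jointly smooth on
`S ⊇ [σ, σ₃]`) drift obeys `‖b‖ ≤ B`, the reversed and rescaled function `v(s, x) = W(σ₃ − s/ν, x)`,
`s ∈ [0, ν(σ₃ − σ)]`, belongs to the tree's local time-integrated class of `v_s + a·∇v − Δv = 0`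
with a measurable drift `a` (`= −b(σ₃ − s/ν)/ν` on the block) bounded by `B/ν` (two-sided time
derivative at interior times, fundamental theorem of calculus). -/
theorem doeblin_block_bridge {ν σ₀ σ' σ σ₃ B : ℝ} {S : Set ℝ}
    {b : ℝ → EuclideanSpace ℝ (Fin 3) → EuclideanSpace ℝ (Fin 3)}
    {W : ℝ → EuclideanSpace ℝ (Fin 3) → ℝ} (hν : 0 < ν) (h₀ : σ₀ < σ) (h₁ : σ < σ₃) (h₂ : σ₃ < σ')
    (hb : IsSmoothSpaceTimeOn S b) (hSI : Icc σ σ₃ ⊆ S) (hB : ∀ s ∈ Icc σ σ₃, ∀ x, ‖b s x‖ ≤ B)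
    (hWc : ContDiffOn ℝ 2 (uncurry W) (Ioo σ₀ σ' ×ˢ univ))
    (hWe : ∀ τ ∈ Ioo σ₀ σ', ∀ x, timeDerivWithin (Ioo σ₀ σ') W τ x + fderiv ℝ (W τ) x (b τ x) +
      ν * (Δ (W τ)) x = 0) :
    ∃ a : ℝ → EuclideanSpace ℝ (Fin 3) → EuclideanSpace ℝ (Fin 3),
      IsDriftHeatSolutionOn a (fun s => W (σ₃ - s / ν)) (B / ν) (Icc 0 (ν * (σ₃ - σ))) univ := by
  have hIoo : Icc σ σ₃ ⊆ Ioo σ₀ σ' := fun s hs => ⟨h₀.trans_le hs.1, hs.2.trans_lt h₂⟩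
  have hO : IsOpen (Ioo σ₀ σ' ×ˢ (univ : Set (EuclideanSpace ℝ (Fin 3)))) :=
    isOpen_Ioo.prod isOpen_univ
  obtain ⟨cl, hcl⟩ : ∃ cl : ℝ → ℝ, cl = fun s => max σ (min σ₃ (σ₃ - s / ν)) := ⟨_, rfl⟩
  have hclc : Continuous cl := by
    rw [hcl]
    exact continuous_const.max (continuous_const.min
      (continuous_const.sub (continuous_id.div_const ν)))
  have hclmem : ∀ s, cl s ∈ Icc σ σ₃ := fun s => by
    rw [hcl]
    exact ⟨le_max_left _ _, max_le h₁.le (min_le_left _ _)⟩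
  have hclS : ∀ s ∈ Icc 0 (ν * (σ₃ - σ)), cl s = σ₃ - s / ν := fun s hs => by
    rw [hcl]; exact (doeblin_clamp hν hs).1
  have hsS : ∀ s ∈ Icc 0 (ν * (σ₃ - σ)), σ₃ - s / ν ∈ Icc σ σ₃ := fun s hs =>
    (doeblin_clamp hν hs).2
  -- the drift
  have hac :
      Continuous fun p : ℝ × EuclideanSpace ℝ (Fin 3) => (-(1 / ν) : ℝ) • b (cl p.1) p.2 := by
    have h1 : Continuous fun p : ℝ × EuclideanSpace ℝ (Fin 3) => (cl p.1, p.2) := by fun_prop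
    have h2 : Continuous fun p : ℝ × EuclideanSpace ℝ (Fin 3) => b (cl p.1) p.2 :=
      hb.continuousOn.comp_continuous h1 (fun p => mk_mem_prod (hSI (hclmem p.1)) (mem_univ _))
    exact (continuous_const (y := (-(1 / ν) : ℝ))).smul h2
  have hJ1 := lowerOfUpper_continuousOn_fderiv_slice isOpen_Ioo hWc
  have hJ2 := lowerOfUpper_continuousOn_laplacian_slice isOpen_Ioo hWc
  have hmap : Continuous fun p : ℝ × EuclideanSpace ℝ (Fin 3) => (σ₃ - p.1 / ν, p.2) := by
    fun_prop
  have hmaps : MapsTo (fun p : ℝ × EuclideanSpace ℝ (Fin 3) => (σ₃ - p.1 / ν, p.2))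
      (Icc 0 (ν * (σ₃ - σ)) ×ˢ univ) (Ioo σ₀ σ' ×ˢ univ) := fun p hp =>
    mk_mem_prod (hIoo (hsS p.1 hp.1)) (mem_univ _)
  have hD : ContinuousOn (fun p : ℝ × EuclideanSpace ℝ (Fin 3) => fderiv ℝ (W (σ₃ - p.1 / ν)) p.2)
      (Icc 0 (ν * (σ₃ - σ)) ×ˢ univ) := by
    have h := hJ1.comp hmap.continuousOn hmaps
    exact h
  have hL : ContinuousOn (fun p : ℝ × EuclideanSpace ℝ (Fin 3) => (Δ (W (σ₃ - p.1 / ν))) p.2)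
      (Icc 0 (ν * (σ₃ - σ)) ×ˢ univ) := by
    have h := hJ2.comp hmap.continuousOn hmaps
    exact h
  refine ⟨fun s x => (-(1 / ν) : ℝ) • b (cl s) x, hac.measurable, ?_, ?_, hD, hL, ?_⟩
  · intro s _ x _
    rw [norm_smul, norm_neg, norm_div, norm_one, Real.norm_of_nonneg hν.le]
    calc 1 / ν * ‖b (cl s) x‖ ≤ 1 / ν * B :=
          mul_le_mul_of_nonneg_left (hB _ (hclmem s) x) (by positivity)
      _ = B / ν := by ring
  · intro s hs
    exact (doeblin_contDiff_slice_open hWc (hIoo (hsS s hs))).contDiffOn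
  · intro x _ s₁ hs₁ s₂ hs₂ h12
    have hsub : uIcc s₁ s₂ ⊆ Icc 0 (ν * (σ₃ - σ)) := by
      rw [uIcc_of_le h12]; exact Icc_subset_Icc hs₁.1 hs₂.2
    have hderiv : ∀ r ∈ uIcc s₁ s₂, HasDerivAt (fun r' => W (σ₃ - r' / ν) x)
        ((Δ (W (σ₃ - r / ν))) x -
          fderiv ℝ (W (σ₃ - r / ν)) x ((-(1 / ν) : ℝ) • b (cl r) x)) r := by
      intro r hr
      have hrS := hsub hr
      have hs := hIoo (hsS r hrS)
      have hd : HasFDerivAt (uncurry W) (fderiv ℝ (uncurry W) (σ₃ - r / ν, x)) (σ₃ - r / ν, x) :=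
        ((hWc.differentiableOn (by norm_num)).differentiableAt
          (hO.mem_nhds (mk_mem_prod hs (mem_univ x)))).hasFDerivAt
      have htl := hasDerivAt_timeLine hd
      have heq := hWe (σ₃ - r / ν) hs x
      rw [timeDerivWithin_eq_deriv_of_mem_nhds (Ioo_mem_nhds hs.1 hs.2), htl.deriv] at heq
      have hlin : HasDerivAt (fun r' : ℝ => σ₃ - r' / ν) (-(1 / ν)) r := by
        simpa using ((hasDerivAt_id r).div_const ν).const_sub σ₃
      refine (htl.comp r hlin).congr_deriv ?_
      rw [hclS r hrS, map_smul, smul_eq_mul,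
        show fderiv ℝ (uncurry W) (σ₃ - r / ν, x) (1, 0) =
          -(fderiv ℝ (W (σ₃ - r / ν)) x (b (σ₃ - r / ν) x)) - ν * (Δ (W (σ₃ - r / ν))) x by
            linarith]
      field_simp
      ring
    have hcont : ContinuousOn (fun r => (Δ (W (σ₃ - r / ν))) x -
        fderiv ℝ (W (σ₃ - r / ν)) x ((-(1 / ν) : ℝ) • b (cl r) x)) (uIcc s₁ s₂) := by
      have e1 := continuousOn_time_slice
        (F := fun p : ℝ × EuclideanSpace ℝ (Fin 3) => (Δ (W (σ₃ - p.1 / ν))) p.2) hL (mem_univ x)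
        hsub
      have e2 := continuousOn_time_slice
        (F := fun p : ℝ × EuclideanSpace ℝ (Fin 3) => fderiv ℝ (W (σ₃ - p.1 / ν)) p.2) hD
        (mem_univ x) hsub
      have e3 : Continuous fun r : ℝ => (-(1 / ν) : ℝ) • b (cl r) x :=
        hac.comp (continuous_id.prodMk continuous_const)
      exact e1.sub (e2.clm_apply e3.continuousOn)
    exact (intervalIntegral.integral_eq_sub_of_hasDerivAt hderiv hcont.intervalIntegrable).symm


/-- **Gaussian lower bound at the bottom of a block by the mass of a weight at its top.** In the
situation of `doeblin_block_bridge` (`‖b‖ ≤ B` on `[σ, σ₃]`, `B ≥ 0`) with `W ≥ 0` on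
`(σ₀, σ') × ℝ³`, for every continuous weight `0 ≤ φ ≤ W(σ₃, ·)` with `tsupport φ ⊆ B̄(x₀, r_s)`,
`r_s > 0`, and every `x ∈ B̄(x₀, r_e)`:
`(∫ φ) · kSubLow 3 (B/ν) (r_e + r_s) (ν(σ₃ − σ)) ≤ W(σ, x)` — the tree's
`IsDriftHeatSolutionOn.kernel_lower_bound` for the reversed function on the balls `B̄(x₀, ρ′)`
(nonnegativity of `W` on their boundary), in the limit `ρ′ → ∞` where the boundary correction
`gaussTail 3 (ρ′ − r_s) (ν(σ₃ − σ))` vanishes. -/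
theorem doeblin_block_lower {ν σ₀ σ' σ σ₃ B rs re : ℝ} {S : Set ℝ}
    {b : ℝ → EuclideanSpace ℝ (Fin 3) → EuclideanSpace ℝ (Fin 3)}
    {W : ℝ → EuclideanSpace ℝ (Fin 3) → ℝ} {x₀ : EuclideanSpace ℝ (Fin 3)}
    {φ : EuclideanSpace ℝ (Fin 3) → ℝ} (hν : 0 < ν) (h₀ : σ₀ < σ) (h₁ : σ < σ₃) (h₂ : σ₃ < σ')
    (hb : IsSmoothSpaceTimeOn S b) (hSI : Icc σ σ₃ ⊆ S) (hB : ∀ s ∈ Icc σ σ₃, ∀ x, ‖b s x‖ ≤ B)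
    (hB0 : 0 ≤ B) (hWc : ContDiffOn ℝ 2 (uncurry W) (Ioo σ₀ σ' ×ˢ univ))
    (hWe : ∀ τ ∈ Ioo σ₀ σ', ∀ x, timeDerivWithin (Ioo σ₀ σ') W τ x + fderiv ℝ (W τ) x (b τ x) +
      ν * (Δ (W τ)) x = 0)
    (hW0 : ∀ τ ∈ Ioo σ₀ σ', ∀ x, 0 ≤ W τ x) (hφ : Continuous φ) (h0 : ∀ z, 0 ≤ φ z)
    (hφW : ∀ z, φ z ≤ W σ₃ z) (hrs : 0 < rs) (hsupp : tsupport φ ⊆ closedBall x₀ rs) :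
    ∀ x ∈ closedBall x₀ re,
      (∫ z, φ z) * kSubLow 3 (B / ν) (re + rs) (ν * (σ₃ - σ)) ≤ W σ x := by
  intro x hx
  obtain ⟨a, hv⟩ := doeblin_block_bridge hν h₀ h₁ h₂ hb hSI hB hWc hWe
  have hτ : 0 < σ₃ - σ := sub_pos.2 h₁
  have hστ : 0 < ν * (σ₃ - σ) := mul_pos hν hτ
  have hA : 0 ≤ B / ν := div_nonneg hB0 hν.le
  have hIoo : ∀ s ∈ Icc 0 (ν * (σ₃ - σ)), σ₃ - s / ν ∈ Ioo σ₀ σ' := fun s hs =>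
    have h := (doeblin_clamp hν hs).2
    ⟨h₀.trans_le h.1, h.2.trans_lt h₂⟩
  have e1 : σ₃ - ν * (σ₃ - σ) / ν = σ := by field_simp; ring
  -- comparison on the balls `B̄(x₀, ρ′)`
  have hev : ∀ᶠ ρ' in atTop, (∫ z, φ z) *
      (kSubLow 3 (B / ν) (re + rs) (ν * (σ₃ - σ)) - gaussTail 3 (ρ' - rs) (ν * (σ₃ - σ))) ≤
        W σ x := by
    filter_upwards [eventually_ge_atTop (max re (rs + 2 * 3 * (ν * (σ₃ - σ)) + 1))] with ρ' hρ'
    have hreρ : re ≤ ρ' := (le_max_left _ _).trans hρ'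
    have h2 : rs + 2 * 3 * (ν * (σ₃ - σ)) + 1 ≤ ρ' := (le_max_right _ _).trans hρ'
    have hNσ : 0 ≤ 2 * 3 * (ν * (σ₃ - σ)) := by positivity
    have hd1 : 1 ≤ ρ' - rs := by linarith
    have hrsρ : rs < ρ' := by linarith
    have hroom : 2 * (3 : ℝ) * (ν * (σ₃ - σ) - 0) < (ρ' - rs) ^ 2 := by
      have : ρ' - rs ≤ (ρ' - rs) ^ 2 := by nlinarith
      rw [sub_zero]
      linarith
    have key := hv.kernel_lower_bound isOpen_univ hA (c := x₀) hrs hrsρ hreρ Subset.rfl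
      (subset_univ _) (by simpa only [finrank_euclideanSpace_fin, Nat.cast_ofNat] using hroom)
      (fun s hs z _ => hW0 _ (hIoo s hs) z) hφ h0 hsupp
      (fun z _ => by
        show φ z ≤ W (σ₃ - 0 / ν) z
        rw [zero_div, sub_zero]
        exact hφW z)
      (ν * (σ₃ - σ)) ⟨hστ, le_rfl⟩ x hx
    simpa only [sub_zero, e1, finrank_euclideanSpace_fin, Nat.cast_ofNat] using key
  -- the limit `ρ′ → ∞`
  have hg : Tendsto (fun ρ' : ℝ => gaussTail 3 (ρ' - rs) (ν * (σ₃ - σ))) atTop (𝓝 0) := by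
    have e2 : Tendsto (fun ρ' : ℝ => ρ' - rs) atTop atTop :=
      tendsto_atTop_atTop.2 fun c => ⟨c + rs, fun a ha => by linarith⟩
    have e3 : Tendsto (fun d : ℝ => Real.exp (-d ^ 2 / (4 * (ν * (σ₃ - σ))))) atTop (𝓝 0) := by
      refine Real.tendsto_exp_atBot.comp ?_
      exact (tendsto_neg_atTop_atBot.comp (tendsto_pow_atTop two_ne_zero)).atBot_div_const
        (by positivity)
    have e4 : Tendsto (fun d : ℝ => gaussTail 3 d (ν * (σ₃ - σ))) atTop (𝓝 0) := by
      have := e3.const_mul ((4 * π * (ν * (σ₃ - σ))) ^ (-(3:ℝ) / 2))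
      rw [mul_zero] at this
      exact this
    exact e4.comp e2
  have hlim := (tendsto_const_nhds (x := ∫ z, φ z)).mul
    ((tendsto_const_nhds (x := kSubLow 3 (B / ν) (re + rs) (ν * (σ₃ - σ)))).sub hg)
  have := le_of_tendsto hlim hev
  simpa only [sub_zero] using this


/-! ### Registered sub-goal -/

/-- **Registered sub-goal `stub_doeblin_blockLower`** (the explicit form of `doeblin_block_lower`,
the minorisation of the Doeblin step): a nonnegative classical solution of the adjoint equation on
`(σ₀, σ') × ℝ³` is bounded below at the bottom `σ` of a block `[σ, σ₃] ⊂ (σ₀, σ')` by the mass of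
any continuous weight `0 ≤ φ ≤ W(σ₃, ·)` carried by `B̄(x₀, r_s)`, times the explicit profile
`kSubLow 3 (B/ν) (r_e + r_s) (ν(σ₃ − σ))`, on `B̄(x₀, r_e)`. -/
theorem stub_doeblin_blockLower :
    ∀ (ν σ₀ σ' σ σ₃ B rs re : ℝ) (S : Set ℝ) (b : ℝ → (EuclideanSpace ℝ (Fin 3)) → (EuclideanSpace ℝ (Fin 3))) (W : ℝ → (EuclideanSpace ℝ (Fin 3)) → ℝ) (x₀ : (EuclideanSpace ℝ (Fin 3))) (φ : (EuclideanSpace ℝ (Fin 3)) → ℝ), 0 < ν → σ₀ < σ → σ < σ₃ → σ₃ < σ' → IsSmoothSpaceTimeOn S b → Icc σ σ₃ ⊆ S → (∀ s ∈ Icc σ σ₃, ∀ x, ‖b s x‖ ≤ B) → 0 ≤ B → ContDiffOn ℝ 2 (uncurry W) (Ioo σ₀ σ' ×ˢ univ) → (∀ τ ∈ Ioo σ₀ σ', ∀ x, timeDerivWithin (Ioo σ₀ σ') W τ x + fderiv ℝ (W τ) x (b τ x) + ν * Laplacian.laplacian (W τ) x = 0) → (∀ τ ∈ Ioo σ₀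 σ', ∀ x, 0 ≤ W τ x) → Continuous φ → (∀ z, 0 ≤ φ z) → (∀ z, φ z ≤ W σ₃ z) → 0 < rs → tsupport φ ⊆ Metric.closedBall x₀ rs → ∀ x ∈ Metric.closedBall x₀ re, (∫ z, φ z) * kSubLow 3 (B / ν) (re + rs) (ν * (σ₃ - σ)) ≤ W σ x :=
  fun _ _ _ _ _ _ _ _ _ _ _ _ _ hν h₀ h₁ h₂ hb hSI hB hB0 hWc hWe hW0 hφ h0 hφW hrs hsupp =>
    doeblin_block_lower hν h₀ h₁ h₂ hb hSI hB hB0 hWc hWe hW0 hφ h0 hφW hrs hsupp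

end Summit.NavierStokesRegularity.NavierStokesRegularity.Theorems.AdaptedFrequencyConverges.CloudFrameEffectiveTsai

end
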